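import Mathlib
import HarnessLib
import Summits.NavierStokesRegularity.NavierStokesRegularity.Theorems.UnthreadedRigidityDoorUnthreadedRigidityThreadingJetsWindowPressure

/-!
# Route `UnthreadedRigidityDoor`, item `UnthreadedRigidity` (W2, stmt-NavierStokesRegularity-27585) — THREADING JETS, WINDOW SILENCE:
# bridge V-W `VirialHorn.VirialWindowSilence` from the ORDER-TWO SLICE LAW (LINE g11-1 «VIRIAL HORN», the window bridge's «M-part»)

Seat ns-crc-p1 g8 (director-ns dss_142), `--supports stmt-NavierStokesRegularity-27585 --as helper`.  Inputs BY NAME: the pressure gauge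
`exists_classical_decaying_pressure` (`…ThreadingJetsWindowPressure`), the open-window dictionary `iteratedDeriv_two_threadingFlux_eq_fluxJetTwo`
and the pressure Poisson equation `laplacian_pressure_eq` (`…ThreadingJetsSlice`), the slice law `OrderTwoSliceLaw` (`…ThreadingJetsDefs`).

★ `virialWindowSilence_of_sliceLaw : OrderTwoSliceLaw → (admissible shells have L⁴ slices) → VirialHorn.VirialWindowSilence`.  At a time `t`
of the window: the pressure gauge supplies a classical pressure on a strip around `t` decaying at infinity at time `t`; the flux of the
UNTHREADED window vanishes identically on the open time set, so its second jet at `t` vanishes (`iteratedDeriv_two_threadingFlux_eq_zero_of_unthreaded`)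
and so does the formal jet `fluxJetTwo (u t) (p t) x₀`; the slice `u t = sepShellL (H t) (Y t) x₀` is smooth and divergence free, `p t` is
smooth, solves the pressure Poisson equation and decays — exactly the hypotheses of `OrderTwoSliceLaw`.  The second hypothesis is the
explicit-field (S-sized, «L-type») fact `∀ l H Y x₀, 1 ≤ l → VirialAdmissible l H → IsSolidHarmonic l Y → MemLp (sepShellL H Y x₀) 4 volume`
(`|curl curl (H Y y)| ≲ |y|⁻³` from the admissible decay), spelled out as a hypothesis, not named (D-0026).

So BOTH slice bridge V (`orderTwoVirialIdentity_of_sliceLaw`) AND window bridge V-W now hang on the ONE explicit-field identity `OrderTwoSliceLaw`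
(plus the `L⁴` size of shells for V-W); with g7's/crc-p2's compositions (`isotypicWindowRigidity_two_of_bridges'`: W → V-W → window rung at
l = 2) the isotypic WINDOW RUNG at `l ≤ 2` waits on bridge W and on `OrderTwoSliceLaw` (+ `L⁴`).

HONEST FRAMING: bookkeeping (M-part) of one RUNG line's window bridge for HYPOTHETICAL window solutions; the slice law (L) is NOT proved here;
nothing here bears on `UnthreadedRigidity` (27585), the door Target, W2 or Navier–Stokes regularity; no summit statement is proved.
MODEL/rung work. [folklore]
-/

noncomputable section

-- the summit and its single sub-problem share the name (CONVENTIONS §1), as in every Theorems file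
set_option linter.dupNamespace false

namespace Summit.NavierStokesRegularity.NavierStokesRegularity.Theorems.UnthreadedRigidity.ThreadingJets

open Set Function Filter Topology MeasureTheory
open scoped RealInnerProductSpace InnerProductSpace ContDiff Laplacian ENNReal NNReal
open Literature.Analysis.FluidPDE
open Literature.Analysis.UnboundedOperators (heatExtension)
open Summit.NavierStokesRegularity.NavierStokesRegularity.Theorems.UnthreadedRigidity.ProfileHorn (E3 threadingFlux)
open Summit.NavierStokesRegularity.NavierStokesRegularity.Theorems.UnthreadedRigidity.VirialHorn
  (IsSolidHarmonic VirialAdmissible sepShellL virialMoment angForm VirialWindowSilence)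

variable {S : Set ℝ} {u : ℝ → E3 → E3}

/-! ### Bridge V-W from the slice law -/

/-- The threading flux of an unthreaded window has vanishing second time-jet at every time of the (open) window. [folklore] -/
theorem iteratedDeriv_two_threadingFlux_eq_zero_of_unthreaded (hS : IsOpen S) {x₀ : E3}
    (hunth : ∀ t ∈ S, ∀ x, inner ℝ (curl (u t) x) (x - x₀) = 0) {t : ℝ} (ht : t ∈ S) (x : E3) :
    iteratedDeriv 2 (fun τ => threadingFlux u x₀ τ x) t = 0 := by
  have h0 : (fun τ => threadingFlux u x₀ τ x) =ᶠ[𝓝 t] fun _ => (0 : ℝ) := by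
    filter_upwards [hS.mem_nhds ht] with τ hτ
    exact hunth τ hτ x
  rw [h0.iteratedDeriv_eq, iteratedDeriv_const]
  simp

/-- ★ **BRIDGE V-W IS L-ONLY (modulo the `L⁴` size of admissible shells)**: the ORDER-TWO SLICE LAW, together with the explicit-field fact that
admissible separable shells have slices in `L⁴(ℝ³)`, implies bridge V-W `VirialHorn.VirialWindowSilence`.  At a time `t` of the window:
the pressure gauge (`exists_classical_decaying_pressure`) supplies a classical pressure on a strip around `t` decaying at infinity at time `t`;
the flux vanishes identically on the open window, so its second jet at `t` vanishes, and by the open-window dictionary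
(`iteratedDeriv_two_threadingFlux_eq_fluxJetTwo`) so does the formal jet `fluxJetTwo (u t) (p t) x₀`; the slice `u t = sepShellL (H t) (Y t) x₀`
is smooth and divergence free, `p t` is smooth, solves the pressure Poisson equation (`laplacian_pressure_eq`) and decays — exactly the
hypotheses of `OrderTwoSliceLaw`. [folklore] -/
theorem virialWindowSilence_of_sliceLaw (hL : OrderTwoSliceLaw)
    (h4 : ∀ (l : ℕ) (H : ℝ → ℝ) (Y : E3 → ℝ) (x₀ : E3), 1 ≤ l → VirialAdmissible l H → IsSolidHarmonic l Y →
      MemLp (sepShellL H Y x₀) 4 volume) :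
    VirialWindowSilence := by
  intro l S hl hS u x₀ hcont hdiv hmild hbdd hunth Hf Yf hsep t ht ξ
  have h4' : ∀ τ ∈ S, MemLp (u τ) 4 volume := fun τ hτ => by
    obtain ⟨hH, hY, hu⟩ := hsep τ hτ
    rw [hu]
    exact h4 l _ _ _ hl hH hY
  obtain ⟨s, T₂, hst, htT, hJS, p, hcl, hdec⟩ := exists_classical_decaying_pressure hS hcont hdiv hmild hbdd h4' ht
  have htJ : t ∈ Ioo s T₂ := ⟨hst, htT⟩
  obtain ⟨hH, hY, hu⟩ := hsep t ht
  have hjet : ∀ x : E3, fluxJetTwo (sepShellL (Hf t) (Yf t) x₀) (p t) x₀ x = 0 := fun x => by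
    rw [← hu, ← iteratedDeriv_two_threadingFlux_eq_fluxJetTwo hcl isOpen_Ioo htJ]
    exact iteratedDeriv_two_threadingFlux_eq_zero_of_unthreaded hS hunth ht x
  have hsm : ContDiff ℝ ∞ (sepShellL (Hf t) (Yf t) x₀) := by rw [← hu]; exact hcl.contDiff_velocity htJ
  have hdv : VectorCalculus.IsDivFree (sepShellL (Hf t) (Yf t) x₀) := by rw [← hu]; exact hdiv t ht
  have hps : ContDiff ℝ ∞ (p t) := hcl.contDiff_pressure htJ
  have hcl' : Ioo s T₂ ⊆ closure (interior (Ioo s T₂)) := by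
    rw [isOpen_Ioo.interior_eq]; exact subset_closure
  have hpoi : ∀ x : E3, (Δ (p t)) x =
      -VectorCalculus.divergence (convect (sepShellL (Hf t) (Yf t) x₀) (sepShellL (Hf t) (Yf t) x₀)) x := fun x => by
    rw [← hu]
    exact laplacian_pressure_eq hcl isOpen_Ioo.uniqueDiffOn hcl' htJ x
  exact hL l x₀ (Yf t) (Hf t) (p t) hl hY hH hsm hdv hps hpoi hdec hjet ξ

end Summit.NavierStokesRegularity.NavierStokesRegularity.Theorems.UnthreadedRigidity.ThreadingJets

end
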